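import Mathlib
import Summits.Ventures.PercRepro.TriangleCapPathWitness
import Summits.Ventures.PercRepro.TriangleCapLeafWitness

/-!
# PercRepro — THE EXTREMAL BAND VALUE OF THE PAIR-COUNT SPECTRUM ON `n` VERTICES, ALL THREE REGIMES (p3, gen 51;
part 247)

For triangle-free graphs on `n = ℓ + 1 + (s − t)` vertices with `s` edges and a star centre of degree `s − t` (so `ℓ`
non-neighbours), the band-`t` value `2 j` is bounded by, and attains (`vertex_band_extremal`):
* `ℓ ≥ 2 t`: `2 j ≤ t (t + 1)` — the full band, the star plus a matching (`full_band_attained_vertices`, the layer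
  witness with `a = t + 1`);
* `t ≤ ℓ ≤ 2 t`: `2 j + 2 t ≤ t (t − 1) + 2 ℓ`, i.e. `j ≤ C(t, 2) + ℓ − t` — the path witness (part 246; at `ℓ = t`
  the leaf witness);
* `ℓ ≤ t`: `2 j + 2 q t ≤ t (t − 1) + ℓ q (q + 1)`, `q = ⌊t / ℓ⌋`, i.e. `j ≤ C(t, 2) − ℓ C(q, 2) − ρ q` — the leaf
  witness (part 244).
The bounds are part 243's sharp bound at `q = 0, 1, ⌊t / ℓ⌋`.  Axioms: standard.
-/

namespace PercRepro

namespace TriangleCap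

namespace C047

open Finset

/-- **THE FULL BAND ON `n` VERTICES** (`1 ≤ t`, `2 t ≤ s`, `t + 1 + s ≤ n`, i.e. `ℓ ≥ 2 t`): the star plus a
matching, `Σ d² + 2 t (s − t − 1) + t (t + 1) = s (s + 1)`. -/
theorem full_band_attained_vertices (n s t : ℕ) (ht : 1 ≤ t) (hs : 2 * t ≤ s) (hn : t + 1 + s ≤ n) :
    ∃ (H : SimpleGraph (Fin n)) (_ : DecidableRel H.Adj), H.CliqueFree 3 ∧ H.edgeFinset.card = s ∧
      (∃ w, deg H w + t = s) ∧ ∑ v, deg H v * deg H v + 2 * (t * (s - t - 1)) + t * (t + 1) = s * (s + 1) := by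
  have hn0 : 0 < n := by omega
  have ha : t + 1 ≤ t + 1 := le_rfl
  have hr : t + 0 ≤ s := by omega
  have han : t + 1 + s ≤ n := hn
  refine ⟨missingGraph (layerWitness n (t + 1) s t 0 0 hn0) (leftPart n (t + 1)), inferInstance,
    cliqueFree_of_bipSub _ _ (bipSub_missingGraph _ _),
    card_edges_missingGraph_layerWitness n (t + 1) s t 0 0 hn0 ha hr han,
    ⟨fin' n hn0 0, by rw [deg_missingGraph_layerWitness_zero n (t + 1) s t 0 0 hn0 ha hr han]; omega⟩, ?_⟩
  have hdec := sum_deg_sq_vertex_decomposition (missingGraph (layerWitness n (t + 1) s t 0 0 hn0) (leftPart n (t + 1)))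
    (fin' n hn0 0)
  rw [deg_missingGraph_layerWitness_zero n (t + 1) s t 0 0 hn0 ha hr han,
    offEdges_missingGraph_layerWitness n (t + 1) s t 0 0 hn0 ha hr han, card_layerPairs n (t + 1) s t 0 0 hn0 ha hr han,
    attach_layerWitness n (t + 1) s t 0 0 hn0 (by omega) ha hr han,
    offAdjPairs_layerWitness n (t + 1) s t 0 0 hn0 ht (by omega) ha hr han] at hdec
  rw [hdec]
  have h1 : t ≤ s := by omega
  have h2 : 1 ≤ s - t := by omega
  zify [h1, h2]
  ring

/-- **THE EXTREMAL BAND VALUE ON `n` VERTICES** (`1 ≤ ℓ`, `1 ≤ t`, `2 t ≤ s`; graphs on `ℓ + 1 + (s − t)` vertices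
with `s` edges and a vertex of degree `s − t`): (i) the bounds `2 j ≤ t (t + 1)`, `2 j + 2 t ≤ t (t − 1) + 2 ℓ`
(`t ≤ ℓ`), `2 j + 2 q t ≤ t (t − 1) + ℓ q (q + 1)` (`ℓ ≤ t`, `q = ⌊t / ℓ⌋`); (ii) each is attained in its regime
(`2 t ≤ ℓ`; `t + 1 ≤ ℓ ≤ 2 t`; `ℓ ≤ t`). -/
theorem vertex_band_extremal (ℓ s t : ℕ) (hℓ : 1 ≤ ℓ) (ht : 1 ≤ t) (hs : 2 * t ≤ s) :
    (∀ (H : SimpleGraph (Fin (ℓ + 1 + (s - t)))) [DecidableRel H.Adj], H.CliqueFree 3 → H.edgeFinset.card = s →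
        ∀ w, deg H w + t = s → ∀ j, ∑ v, deg H v * deg H v + 2 * (t * (s - t - 1)) + 2 * j = s * (s + 1) →
        2 * j ≤ t * (t + 1) ∧ (t ≤ ℓ → 2 * j + 2 * t ≤ t * (t - 1) + 2 * ℓ) ∧
        (ℓ ≤ t → 2 * j + 2 * (t / ℓ) * t ≤ t * (t - 1) + ℓ * ((t / ℓ) * (t / ℓ + 1)))) ∧
      ((2 * t ≤ ℓ → ∃ (H : SimpleGraph (Fin (ℓ + 1 + (s - t)))) (_ : DecidableRel H.Adj), H.CliqueFree 3 ∧
          H.edgeFinset.card = s ∧ (∃ w, deg H w + t = s) ∧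
          ∑ v, deg H v * deg H v + 2 * (t * (s - t - 1)) + t * (t + 1) = s * (s + 1)) ∧
        (t + 1 ≤ ℓ → ℓ ≤ 2 * t → ∃ (H : SimpleGraph (Fin (ℓ + 1 + (s - t)))) (_ : DecidableRel H.Adj) (j : ℕ),
          H.CliqueFree 3 ∧ H.edgeFinset.card = s ∧ (∃ w, deg H w + t = s) ∧
          ∑ v, deg H v * deg H v + 2 * (t * (s - t - 1)) + 2 * j = s * (s + 1) ∧
          2 * j + 2 * t = t * (t - 1) + 2 * ℓ) ∧
        (ℓ ≤ t → ∃ (H : SimpleGraph (Fin (ℓ + 1 + (s - t)))) (_ : DecidableRel H.Adj) (j : ℕ),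
          H.CliqueFree 3 ∧ H.edgeFinset.card = s ∧ (∃ w, deg H w + t = s) ∧
          ∑ v, deg H v * deg H v + 2 * (t * (s - t - 1)) + 2 * j = s * (s + 1) ∧
          2 * j + 2 * (t / ℓ) * t = t * (t - 1) + ℓ * ((t / ℓ) * (t / ℓ + 1)))) := by
  refine ⟨?_, ?_, ?_, ?_⟩
  · intro H _ hfree hm w hw j hS
    have hw1 : 1 ≤ deg H w := by omega
    have hoff : (offEdges H w).card = t := by
      have := card_offEdges_add_deg H w
      omega
    have hkey := (layer_value_iff H s t j hm w hw1 hoff).mp hS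
    refine ⟨by omega, fun _ => ?_, fun hlt => ?_⟩
    · have := band_bound_vertices_sharp H hfree s t j hm w hw1 hoff hS 1 le_rfl
      rw [Fintype.card_fin] at this
      have e : ℓ + 1 + (s - t) - 1 - (s - t) = ℓ := by omega
      rw [e] at this
      omega
    · have hq : 1 ≤ t / ℓ := Nat.div_pos hlt (by omega)
      have := band_bound_vertices_sharp H hfree s t j hm w hw1 hoff hS (t / ℓ) hq
      rw [Fintype.card_fin] at this
      have e : ℓ + 1 + (s - t) - 1 - (s - t) = ℓ := by omega
      rw [e] at this
      exact this
  · intro hℓt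
    exact full_band_attained_vertices (ℓ + 1 + (s - t)) s t ht hs (by omega)
  · intro h1 h2
    exact middle_band_attained ℓ s t ht h1 h2 hs
  · intro _
    exact vertex_band_bottom_attained ℓ s t hℓ ht hs

end C047

end TriangleCap

end PercRepro
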